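import Literature.AlgebraicGeometry.Frobenioids.Cor411iiiAtSetting
import Literature.AlgebraicGeometry.Frobenioids.Thm49CompatOfFunctor
import Literature.AlgebraicGeometry.Frobenioids.Cor411iiAssemblyFSM
import Literature.AlgebraicGeometry.Frobenioids.Prop55Sub
import HarnessLib

/-!
# Frobenioids I, Corollary 4.11 (iii), compatibility clause AS TYPED (`PreFrobenioidData.Cor411iii_compat`)
# — for general Frobenioids over bases of FSM-type, AT THE DATA of Cor. 4.11 (FACT-LIST row F-1028)

Mochizuki, *The geometry of Frobenioids I: the general theory*, Kyushu J. Math. **62** (2008)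
293–400, kurims text: Cor. 4.11 (iii) p. 92 "there exists an isomorphism of functors `Ψ^Φ : Φ₁ ⥲ Φ₂` …
lying over the equivalence `Ψ^Base` … which is compatible [when the `C_i` are of isotropic, but not of
group-like type] with the isomorphism `Ψ^Prime` of Theorem 4.2, (ii)"; proof p. 94 "assertion (iii) follows
formally from assertion (ii); Theorem 4.9 [cf. also Definition 1.3, (i), (a), (b); the technique of …
'`D^* → D`' …]" [cite: MochizukiFrdI2008, Cor. 4.11 (iii) p.92].

PROOF-ONLY companion of `DivisorMonoidCategoryTheoreticity.lean` (seat abc-iut-f-033; FACT-LIST row F-1028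
`PreFrobenioidData.Cor411iii_compat`, [FrdI] Corollary 4.11 (iii) p. 92). The typed compatibility clause is a
schema over the data `(Ψ^Base, Ψ^Φ, Ψ^Prime)`; seat abc-iut-L1-t14's `FrdI.T42.exists_cor411iii_compat_of_setting`
proves it AT THE DATA over the setting of the proof of Thm. 4.2 (perfect type). Here the same is assembled BY
NAME for GENERAL Frobenioids over bases of FSM-type (the cell's standing route to Thm. 3.4 (ii)/(iii) and
Thm. 4.2, which descend THE `Ψ^Prime` and THE `Ψ^Φ` through the perfections):

* `FrdI.exists_cor411iii_compat_of_isOfFSMType` — for Frobenioids `C_i → F_{Φ_i}` with perf-factorial `Φ_i`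
  over bases of FSM-type, of isotropic and non-group-like type (the clause's own proviso) with `C₁` of
  rational type at THE birationalization / THE support predicate (`hrat₁`), under `Cor411Setting`: THE
  `Ψ^Prime = e` of Thm. 4.2 (ii) with its clauses (a), (b) and THE `Ψ^Φ = E` of Thm. 4.9 over `Ψ` with its
  divisor clause and `Thm49_compat E e` (`FrdI.T49.exists_thm49_compat_ofFunctor_of_isOfFSMType`, seats
  abc-iut-w4-d109 / w5), THE `1`-unique `Ψ^Base` of Cor. 4.11 (ii) (`PreFrobenioid.cor411ii_ofFunctor_of_isOfFSMType`,
  seat abc-iut-L1-d6) with `η`, the descended `Ψ^Φ'` on `D₁` over `Ψ^Base`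
  (`DivisorMonoidIsoOver.exists_overBase`) and bijections of primes `e'` over `Ψ^Base` induced by `e`
  (`DivisorMonoidIsoOver.exists_primes_compat_overBase`) for which the typed `Cor411iii_compat Ψ^Φ' e'` holds;
* `PreFrobenioid.cor411iii_compat_holds_of_isOfFSMType` — **the instance form AT THE CONSTRUCTIONS**: the
  same with "`C₁` of rationally standard type" stated at the Def. 4.5 (iii) parameters
  `rsParams hF₁ PrimarySupp` (THE birationalization, THE unit-trivialisation, THE support predicate), which
  supplies `hrat₁`.

The universal closure of the schema in BARE `(E, e)` is not what print asserts and is not claimed (a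
mismatched pair `(Ψ^Φ, e)` violates it trivially). No new definitions; no statement of the paper is restated
or strengthened; nothing here is specific to the abc programme and no side is taken on [IUTchIII] Cor. 3.12.
-/

namespace Literature.AlgebraicGeometry.Frobenioids

open CategoryTheory Opposite

universe w v v' u u'

namespace FrdI

open PreFrobenioid

variable {D₁ : Type u} [Category.{v} D₁] {Φ₁ : D₁ᵒᵖ ⥤ CommMonCat.{w}} {C₁ : Type u'} [Category.{v'} C₁]
  {D₂ : Type u} [Category.{v} D₂] {Φ₂ : D₂ᵒᵖ ⥤ CommMonCat.{w}} {C₂ : Type u'} [Category.{v'} C₂]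
  {F₁ : C₁ ⥤ ElemFrobenioid Φ₁} {F₂ : C₂ ⥤ ElemFrobenioid Φ₂}

set_option backward.isDefEq.respectTransparency false in
/-- **[FrdI] Cor. 4.11 (iii) WITH its compatibility clause (typed `Cor411iii_compat`), for general
Frobenioids over bases of FSM-type, AT THE DATA** ("compatible [when the `C_i` are of isotropic, but not of
group-like type] with the isomorphism `Ψ^Prime` of Theorem 4.2, (ii)", p. 92): for Frobenioids
`C_i → F_{Φ_i}` with perf-factorial `Φ_i` over bases `D_i` of FSM-type, of isotropic and non-group-like type,
`C₁` of rational type at THE birationalization / THE support predicate `PrimarySupp`, and an equivalence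
`Ψ : C₁ ⥲ C₂` in the setting of Cor. 4.11 (`Cor411Setting`: Div-slim bases, standard type, hypothesis (b)),
there are: THE `Ψ^Prime = e` of Thm. 4.2 (ii) (clauses (a), (b) on the co-angular pre-steps out of / into
each `A`), THE `Ψ^Φ = E : Φ₁ ⥲ Φ₂` over `Ψ` of Thm. 4.9 computing `Div(Ψ φ) = Ψ^Φ_A(Div φ)` on pre-steps with
its compatibility clause `Thm49_compat E e`, THE `1`-unique `Ψ^Base` of (ii) with
`η : Base₂ ∘ Ψ ≅ Ψ^Base ∘ Base₁`, the descended `Ψ^Φ'` ON `D₁` over `Ψ^Base` (at `Base A`: `Ψ^Φ_A` followed by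
`(η_A⁻¹)^*`), and bijections of primes `e'` over `Ψ^Base` induced by `e`, for which the typed
`Cor411iii_compat Ψ^Φ' e'` holds. [cite: MochizukiFrdI2008, Cor. 4.11 (iii) p.92] -/
theorem exists_cor411iii_compat_of_isOfFSMType (hF₁ : IsFrobenioid F₁) (hF₂ : IsFrobenioid F₂)
    (hD₁ : IsOfFSMType D₁) (hD₂ : IsOfFSMType D₂)
    (hpf₁ : Objectwise (fun M _ => IsPerfFactorial M) Φ₁) (hpf₂ : Objectwise (fun M _ => IsPerfFactorial M) Φ₂)
    (hrat₁ : ∀ A : C₁, PreFrobenioidData.IsRational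
      (biratData hF₁ (hasBiratSquares_of_isFrobenioid hF₁))
      (S := PreFrobenioidData.ofFunctor Φ₁ F₁) (fun a 𝔭 => PrimarySupp a 𝔭) A)
    (Ψ : C₁ ≌ C₂)
    (histr₁ : (PreFrobenioidData.ofFunctor Φ₁ F₁).IsOfIsotropicType)
    (histr₂ : (PreFrobenioidData.ofFunctor Φ₂ F₂).IsOfIsotropicType)
    (hng₁ : ¬ (PreFrobenioidData.ofFunctor Φ₁ F₁).IsOfGroupLikeType)
    (hng₂ : ¬ (PreFrobenioidData.ofFunctor Φ₂ F₂).IsOfGroupLikeType)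
    (hs : (PreFrobenioidData.ofFunctor Φ₁ F₁).Cor411Setting (PreFrobenioidData.ofFunctor Φ₂ F₂) Ψ) :
    ∃ (e : ∀ A : C₁, Primes (Φ₁.obj (op (baseObj F₁ A))) ≃ Primes (Φ₂.obj (op (baseObj F₂ (Ψ.functor.obj A)))))
      (E : (PreFrobenioidData.ofFunctor Φ₁ F₁).DivisorMonoidIsoOver (PreFrobenioidData.ofFunctor Φ₂ F₂) Ψ)
      (ΨBase : D₁ ⥤ D₂)
      (η : Ψ.functor ⋙ (PreFrobenioidData.ofFunctor Φ₂ F₂).base ≅ (PreFrobenioidData.ofFunctor Φ₁ F₁).base ⋙ ΨBase)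
      (E' : (PreFrobenioidData.ofFunctor Φ₁ F₁).DivisorMonoidIsoOverBase (PreFrobenioidData.ofFunctor Φ₂ F₂) ΨBase)
      (e' : ∀ X : D₁, Primes (Φ₁.obj (op X)) ≃ Primes (Φ₂.obj (op (ΨBase.obj X)))),
      (∀ (A : C₁) (𝔭 : Primes (Φ₁.obj (op (baseObj F₁ A)))),
        (∀ ⦃B : C₁⦄ (φ : A ⟶ B), IsCoAngularPreStep F₁ φ →
            (Div F₁ φ ∈ 𝔭.submonoid ↔ Div F₂ (Ψ.functor.map φ) ∈ (e A 𝔭).submonoid)) ∧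
        ∀ ⦃B : C₁⦄ (ψ : B ⟶ A), IsCoAngularPreStep F₁ ψ →
          ((∃ y ∈ 𝔭.submonoid, pull Φ₁ (Base F₁ ψ) y = Div F₁ ψ) ↔
            ∃ y ∈ (e A 𝔭).submonoid, pull Φ₂ (Base F₂ (Ψ.functor.map ψ)) y = Div F₂ (Ψ.functor.map ψ))) ∧
      (∀ ⦃A B : C₁⦄ (φ : A ⟶ B), IsPreStep F₁ φ → E.iso A (Div F₁ φ) = Div F₂ (Ψ.functor.map φ)) ∧
      (PreFrobenioidData.ofFunctor Φ₁ F₁).Thm49_compat (PreFrobenioidData.ofFunctor Φ₂ F₂) Ψ E e ∧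
      PreFrobenioidData.OneUniqueSquare Ψ.functor (PreFrobenioidData.ofFunctor Φ₁ F₁).base
        (PreFrobenioidData.ofFunctor Φ₂ F₂).base ΨBase ∧
      (∀ (A : C₁) (x : Φ₁.obj (op (baseObj F₁ A))), E'.iso (baseObj F₁ A) x = pull Φ₂ (η.inv.app A) (E.iso A x)) ∧
      (PreFrobenioidData.ofFunctor Φ₁ F₁).Cor411iii_compat (PreFrobenioidData.ofFunctor Φ₂ F₂) E' e' := by
  have hT : PreFrobenioidData.Thm42Setting (PreFrobenioidData.ofFunctor Φ₁ F₁) (PreFrobenioidData.ofFunctor Φ₂ F₂) :=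
    ⟨hs.standard, ⟨histr₁, histr₂⟩, ⟨hng₁, hng₂⟩⟩
  -- THE `Ψ^Prime` and THE `Ψ^Φ` with its divisor clause and compatibility, at the `C`-level
  obtain ⟨E, e, he, hE, hcompat⟩ :=
    FrdI.T49.exists_thm49_compat_ofFunctor_of_isOfFSMType hF₁ hF₂ hD₁ hD₂ hpf₁ hpf₂ hrat₁ Ψ hT
  -- THE `Ψ^Base` of Cor. 4.11 (ii)
  obtain ⟨ΨBase, hsq, -⟩ := cor411ii_ofFunctor_of_isOfFSMType hF₁ hF₂ Ψ hpf₁ hpf₂ hD₁ hD₂ hs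
  obtain ⟨η⟩ := hsq.2.1
  -- descent `D^* ⥲ D`
  obtain ⟨E', hE'⟩ := E.exists_overBase ΨBase η (exists_base_iso_of_isFrobenioid F₁ hF₁)
    (exists_preSteps_of_base_iso F₁ hF₁) (fun A _ f => exists_arrow_over_base F₁ hF₁ A f)
  obtain ⟨e', he'⟩ := E.exists_primes_compat_overBase e ΨBase η E' hE' (exists_base_iso_of_isFrobenioid F₁ hF₁)
  exact ⟨e, E, ΨBase, η, E', e', he, hE, hcompat, hsq, hE',
    fun h₁ h₂ h₃ h₄ X 𝔭 x => he' (fun A 𝔭 x => hcompat h₁ h₂ h₃ h₄ A 𝔭 x) X 𝔭 x⟩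

end FrdI

namespace PreFrobenioid

variable {D₁ : Type u} [Category.{v} D₁] {Φ₁ : D₁ᵒᵖ ⥤ CommMonCat.{w}} {C₁ : Type u'} [Category.{v'} C₁]
  {D₂ : Type u} [Category.{v} D₂] {Φ₂ : D₂ᵒᵖ ⥤ CommMonCat.{w}} {C₂ : Type u'} [Category.{v'} C₂]
  {F₁ : C₁ ⥤ ElemFrobenioid Φ₁} {F₂ : C₂ ⥤ ElemFrobenioid Φ₂}

set_option backward.isDefEq.respectTransparency false in
/-- **[FrdI] Corollary 4.11 (iii), compatibility clause — FACT-LIST row F-1028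
`PreFrobenioidData.Cor411iii_compat`, the instance form AT THE CONSTRUCTIONS over bases of FSM-type** (p. 92):
for Frobenioids `C_i → F_{Φ_i}` (Def. 1.3) with `Φ_i` perf-factorial (§4) over base categories of FSM-type, of
isotropic and non-group-like type (the clause's proviso "when the `C_i` are of isotropic, but not of
group-like type"), `C₁` of rationally standard type at ITS Def. 4.5 (iii) parameters `rsParams hF₁ PrimarySupp`
(THE birationalization, THE unit-trivialisation, THE support predicate of Def. 2.4 (i)(d)), and an equivalence
`Ψ : C₁ ⥲ C₂` in the setting of Cor. 4.11: THE `Ψ^Prime = e` of Thm. 4.2 (ii), THE `Ψ^Φ = E` of Thm. 4.9 with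
its divisor clause and `Thm49_compat E e`, THE `Ψ^Base` of (ii) with `η`, the descended `Ψ^Φ'` on `D₁` over
`Ψ^Base` and the bijections of primes `e'` over `Ψ^Base` induced by `e` exist, and the typed
`Cor411iii_compat Ψ^Φ' e'` holds — `Ψ^Φ'_X` maps `Φ₁(X)_𝔭` onto `Φ₂(Ψ^Base X)_{e'_X(𝔭)}`.
[cite: MochizukiFrdI2008, Cor. 4.11 (iii) p.92] -/
theorem cor411iii_compat_holds_of_isOfFSMType (hF₁ : IsFrobenioid F₁) (hF₂ : IsFrobenioid F₂)
    (hpf₁ : Objectwise (fun M _ => IsPerfFactorial M) Φ₁) (hpf₂ : Objectwise (fun M _ => IsPerfFactorial M) Φ₂)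
    (hD₁ : IsOfFSMType D₁) (hD₂ : IsOfFSMType D₂) (Ψ : C₁ ≌ C₂)
    (histr₁ : (PreFrobenioidData.ofFunctor Φ₁ F₁).IsOfIsotropicType)
    (histr₂ : (PreFrobenioidData.ofFunctor Φ₂ F₂).IsOfIsotropicType)
    (hng₁ : ¬ (PreFrobenioidData.ofFunctor Φ₁ F₁).IsOfGroupLikeType)
    (hng₂ : ¬ (PreFrobenioidData.ofFunctor Φ₂ F₂).IsOfGroupLikeType)
    (hR₁ : (PreFrobenioidData.ofFunctor Φ₁ F₁).IsOfRationallyStandardType (rsParams hF₁ fun a 𝔭 => PrimarySupp a 𝔭))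
    (hs : (PreFrobenioidData.ofFunctor Φ₁ F₁).Cor411Setting (PreFrobenioidData.ofFunctor Φ₂ F₂) Ψ) :
    ∃ (e : ∀ A : C₁, Primes (Φ₁.obj (op (baseObj F₁ A))) ≃ Primes (Φ₂.obj (op (baseObj F₂ (Ψ.functor.obj A)))))
      (E : (PreFrobenioidData.ofFunctor Φ₁ F₁).DivisorMonoidIsoOver (PreFrobenioidData.ofFunctor Φ₂ F₂) Ψ)
      (ΨBase : D₁ ⥤ D₂)
      (η : Ψ.functor ⋙ (PreFrobenioidData.ofFunctor Φ₂ F₂).base ≅ (PreFrobenioidData.ofFunctor Φ₁ F₁).base ⋙ ΨBase)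
      (E' : (PreFrobenioidData.ofFunctor Φ₁ F₁).DivisorMonoidIsoOverBase (PreFrobenioidData.ofFunctor Φ₂ F₂) ΨBase)
      (e' : ∀ X : D₁, Primes (Φ₁.obj (op X)) ≃ Primes (Φ₂.obj (op (ΨBase.obj X)))),
      (∀ (A : C₁) (𝔭 : Primes (Φ₁.obj (op (baseObj F₁ A)))),
        (∀ ⦃B : C₁⦄ (φ : A ⟶ B), IsCoAngularPreStep F₁ φ →
            (Div F₁ φ ∈ 𝔭.submonoid ↔ Div F₂ (Ψ.functor.map φ) ∈ (e A 𝔭).submonoid)) ∧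
        ∀ ⦃B : C₁⦄ (ψ : B ⟶ A), IsCoAngularPreStep F₁ ψ →
          ((∃ y ∈ 𝔭.submonoid, pull Φ₁ (Base F₁ ψ) y = Div F₁ ψ) ↔
            ∃ y ∈ (e A 𝔭).submonoid, pull Φ₂ (Base F₂ (Ψ.functor.map ψ)) y = Div F₂ (Ψ.functor.map ψ))) ∧
      (∀ ⦃A B : C₁⦄ (φ : A ⟶ B), IsPreStep F₁ φ → E.iso A (Div F₁ φ) = Div F₂ (Ψ.functor.map φ)) ∧
      (PreFrobenioidData.ofFunctor Φ₁ F₁).Thm49_compat (PreFrobenioidData.ofFunctor Φ₂ F₂) Ψ E e ∧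
      PreFrobenioidData.OneUniqueSquare Ψ.functor (PreFrobenioidData.ofFunctor Φ₁ F₁).base
        (PreFrobenioidData.ofFunctor Φ₂ F₂).base ΨBase ∧
      (∀ (A : C₁) (x : Φ₁.obj (op (baseObj F₁ A))), E'.iso (baseObj F₁ A) x = pull Φ₂ (η.inv.app A) (E.iso A x)) ∧
      (PreFrobenioidData.ofFunctor Φ₁ F₁).Cor411iii_compat (PreFrobenioidData.ofFunctor Φ₂ F₂) E' e' :=
  FrdI.exists_cor411iii_compat_of_isOfFSMType hF₁ hF₂ hD₁ hD₂ hpf₁ hpf₂ (fun A => hR₁.rational A) Ψ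
    histr₁ histr₂ hng₁ hng₂ hs

end PreFrobenioid

end Literature.AlgebraicGeometry.Frobenioids
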